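import Summits.Ventures.HodgeRepro2.T5SU11ResolventConstantSource
import Summits.Ventures.HodgeRepro2.T5SU11ResolventNeumann
import Summits.Ventures.HodgeRepro2.T5SU11ResolventKernelComposition
import Summits.Ventures.HodgeRepro2.T5SU11RadialGreenPositivity

/-!
# The resolvent in the sup-norm on bounded continuous sources (`λ > 2`): Lipschitz in `μ`, iterates, Neumann series

With row 542's bound `‖G^I_λ g‖_∞ ≤ ‖g‖_∞/μ` (`μ = λ(λ − 2) > 0`) the bounded continuous sources form a class the
resolvent preserves (`continuousOn_greenSolI_of_bounded`, `abs_greenSolI_le_div` of row 542), and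

* **`‖G^I_λ g − G^I_{λ₂} g‖_∞ ≤ |μ − μ₂| ‖g‖_∞/(μ μ₂)`** (`abs_greenSolI_sub_le_div`, row 500's resolvent identity);
* **`‖(G^I_λ)ⁿ g‖_∞ ≤ ‖g‖_∞/μⁿ`** (`abs_iterate_le_div`);
* **the Neumann series `Σ (μ − μ₂)^k (G^I_{λ₂})^{k+1} g` converges to `G^I_λ g` uniformly on `(0, ∞)` for
  `|μ − μ₂| < μ₂`** (`abs_neumann_remainder_le`, `tendsto_neumann_sup`: the remainder is at most
  `(|μ − μ₂|/μ₂)^{n+1} ‖g‖_∞/μ`) — the sup-norm form of rows 506 and 540, with the disc `|μ − μ₂| < μ₂ = dist(μ₂, 0)`;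
* **the row sums of the kernel: `∫_{(0,∞)} |K_λ(t, s)| sinh 2s ds = 1/μ`** for every `t > 0` (`integral_abs_sphGreenKernel_mul_sinh`:
  `K_λ < 0` and `G^I_λ 1 = −1/μ`) — Schur's bound for the `L^∞` (and, by symmetry, the `L¹`) operator norm.

Nothing is claimed about (N).

Blind lane: Mathlib + the HodgeRepro2 prefix only; no sorry; axioms ⊆ {propext, Classical.choice,
Quot.sound}.
-/

namespace Summit.Ventures.HodgeRepro2.T5SU11ResolventSupNorm

open Filter Topology MeasureTheory
open Set (Ioi Ioc)
open T5SU11Cartan T5SU11SphericalFunction T5SU11SphericalDecay T5SU11RadialGreenImproper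
  T5SU11RadialGreenImproperStable T5SU11ResolventIdentityDecay T5SU11ResolventNeumann T5SU11ResolventConstantSource
  T5SU11RadialGreenKernel T5SU11ResolventKernelComposition T5SU11RadialGreenPositivity

section measure

variable [MeasurableSpace Circle] [BorelSpace Circle]

variable {lam : ℝ} (h2 : 2 < lam) {g : ℝ → ℝ} (hg : ContinuousOn g (Ioi 0)) {K : ℝ} (hK : ∀ s, 0 < s → |g s| ≤ K)

include h2 hg hK in
/-- `G^I_λ g` is continuous on `(0, ∞)` for a bounded continuous source, `λ > 2`. -/
theorem continuousOn_greenSolI_of_bounded :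
    ContinuousOn (greenSolI (fun t => sph lam (hyp t)) (sphDecay lam) g) (Ioi 0) :=
  continuousOn_greenSolI (by linarith) hg (M := K) (fun s hs => hK s hs.1)
    (le_trans (abs_nonneg _) (hK 1 one_pos)) (ε := 0) (C := K) (s₀ := 1) (by linarith)
    (fun s hs => by simpa using hK s (by linarith))

include h2 hg hK in
/-- **The resolvent is Lipschitz in `μ` in the sup-norm**: `|G^I_λ g(t) − G^I_{λ₂} g(t)| ≤ |μ − μ₂| ‖g‖_∞/(μ μ₂)` for
`λ, λ₂ > 2` and every `t > 0`. -/
theorem abs_greenSolI_sub_le_div {lam₂ : ℝ} (h2' : 2 < lam₂) {t : ℝ} (ht : 0 < t) :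
    |greenSolI (fun t => sph lam (hyp t)) (sphDecay lam) g t - greenSolI (fun t => sph lam₂ (hyp t)) (sphDecay lam₂) g t|
      ≤ |lam * (lam - 2) - lam₂ * (lam₂ - 2)| * K / (lam * (lam - 2) * (lam₂ * (lam₂ - 2))) := by
  have hK0 : 0 ≤ K := le_trans (abs_nonneg _) (hK 1 one_pos)
  have hμ : 0 < lam * (lam - 2) := mul_pos (by linarith) (by linarith)
  have hμ₂ : 0 < lam₂ * (lam₂ - 2) := mul_pos (by linarith) (by linarith)
  have hid := greenSolI_sub_greenSolI_eq (lam := lam) (lam₂ := lam₂) (by linarith) (by linarith) hg (M := K)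
    (fun s hs => hK s hs.1) hK0 (ε := 0) (C := K) (s₀ := 1) (by linarith) (by linarith)
    (fun s hs => by simpa using hK s (by linarith)) ht
  rw [hid, abs_mul]
  -- `|G^I_λ h(t)| ≤ (K/μ₂)/μ` for `h = G^I_{λ₂} g`
  have hh : ContinuousOn (greenSolI (fun t => sph lam₂ (hyp t)) (sphDecay lam₂) g) (Ioi 0) :=
    continuousOn_greenSolI_of_bounded h2' hg hK
  have hhK : ∀ s, 0 < s → |greenSolI (fun t => sph lam₂ (hyp t)) (sphDecay lam₂) g s| ≤ K / (lam₂ * (lam₂ - 2)) :=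
    fun s hs => abs_greenSolI_le_div (by linarith) h2' hg hK hs
  have hb := abs_greenSolI_le_div (by linarith) h2 hh hhK ht
  calc |lam * (lam - 2) - lam₂ * (lam₂ - 2)| * |greenSolI (fun t => sph lam (hyp t)) (sphDecay lam)
        (greenSolI (fun t => sph lam₂ (hyp t)) (sphDecay lam₂) g) t|
      ≤ |lam * (lam - 2) - lam₂ * (lam₂ - 2)| * (K / (lam₂ * (lam₂ - 2)) / (lam * (lam - 2))) :=
        mul_le_mul_of_nonneg_left hb (abs_nonneg _)
    _ = |lam * (lam - 2) - lam₂ * (lam₂ - 2)| * K / (lam * (lam - 2) * (lam₂ * (lam₂ - 2))) := by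
        field_simp

include h2 hg hK in
/-- **The iterates are bounded and continuous**: `(G^I_λ)ⁿ g` is continuous on `(0, ∞)` with
`|(G^I_λ)ⁿ g| ≤ ‖g‖_∞/μⁿ` there, `λ > 2`. -/
theorem abs_iterate_le_div (n : ℕ) :
    ContinuousOn ((greenSolI (fun t => sph lam (hyp t)) (sphDecay lam))^[n] g) (Ioi 0) ∧
    ∀ s, 0 < s → |((greenSolI (fun t => sph lam (hyp t)) (sphDecay lam))^[n] g) s| ≤ K / (lam * (lam - 2)) ^ n := by
  induction n with
  | zero => exact ⟨by simpa using hg, fun s hs => by simpa using hK s hs⟩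
  | succ n ih =>
    obtain ⟨hcont, hbd⟩ := ih
    refine ⟨?_, fun s hs => ?_⟩
    · rw [Function.iterate_succ_apply']
      exact continuousOn_greenSolI_of_bounded h2 hcont hbd
    · rw [Function.iterate_succ_apply']
      have := abs_greenSolI_le_div (by linarith) h2 hcont hbd hs
      rwa [div_div, ← pow_succ] at this

include h2 hg hK in
/-- **The Neumann remainder in the sup-norm**: for `λ, λ₂ > 2` and every `t > 0`,
`|G^I_λ g(t) − Σ_{k=0}^{n} (μ − μ₂)^k (G^I_{λ₂})^{k+1} g(t)| ≤ (|μ − μ₂|/μ₂)^{n+1} ‖g‖_∞/μ`. -/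
theorem abs_neumann_remainder_le {lam₂ : ℝ} (h2' : 2 < lam₂) (n : ℕ) {t : ℝ} (ht : 0 < t) :
    |greenSolI (fun t => sph lam (hyp t)) (sphDecay lam) g t
        - ∑ k ∈ Finset.range (n + 1), (lam * (lam - 2) - lam₂ * (lam₂ - 2)) ^ k
          * (greenSolI (fun t => sph lam₂ (hyp t)) (sphDecay lam₂))^[k + 1] g t|
      ≤ (|lam * (lam - 2) - lam₂ * (lam₂ - 2)| / (lam₂ * (lam₂ - 2))) ^ (n + 1) * (K / (lam * (lam - 2))) := by
  have hK0 : 0 ≤ K := le_trans (abs_nonneg _) (hK 1 one_pos)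
  have hμ : 0 < lam * (lam - 2) := mul_pos (by linarith) (by linarith)
  have hμ₂ : 0 < lam₂ * (lam₂ - 2) := mul_pos (by linarith) (by linarith)
  have hfin := neumann_finite (lam := lam) (lam₂ := lam₂) (by linarith) (by linarith) hg (M := K)
    (fun s hs => hK s hs.1) hK0 (ε := 0) (C := K) (s₀ := 1) (by linarith) (by linarith)
    (fun s hs => by simpa using hK s (by linarith)) n ht
  rw [hfin, add_sub_cancel_left, abs_mul, abs_pow]
  obtain ⟨hcont, hbd⟩ := abs_iterate_le_div h2' hg hK (n + 1)
  have hb := abs_greenSolI_le_div (by linarith) h2 hcont hbd ht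
  calc |lam * (lam - 2) - lam₂ * (lam₂ - 2)| ^ (n + 1) * |greenSolI (fun t => sph lam (hyp t)) (sphDecay lam)
        ((greenSolI (fun t => sph lam₂ (hyp t)) (sphDecay lam₂))^[n + 1] g) t|
      ≤ |lam * (lam - 2) - lam₂ * (lam₂ - 2)| ^ (n + 1) * (K / (lam₂ * (lam₂ - 2)) ^ (n + 1) / (lam * (lam - 2))) :=
        mul_le_mul_of_nonneg_left hb (by positivity)
    _ = (|lam * (lam - 2) - lam₂ * (lam₂ - 2)| / (lam₂ * (lam₂ - 2))) ^ (n + 1) * (K / (lam * (lam - 2))) := by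
        rw [div_pow]
        field_simp

include h2 hg hK in
/-- **THE NEUMANN SERIES CONVERGES UNIFORMLY ON `(0, ∞)` for `|μ − μ₂| < μ₂`** (`λ, λ₂ > 2`):
`sup_{t > 0} |G^I_λ g(t) − Σ_{k=0}^{n} (μ − μ₂)^k (G^I_{λ₂})^{k+1} g(t)| → 0`, at the geometric rate `(|μ − μ₂|/μ₂)^{n+1}`. -/
theorem tendsto_neumann_sup {lam₂ : ℝ} (h2' : 2 < lam₂)
    (hq : |lam * (lam - 2) - lam₂ * (lam₂ - 2)| < lam₂ * (lam₂ - 2)) :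
    Tendsto (fun n : ℕ => (|lam * (lam - 2) - lam₂ * (lam₂ - 2)| / (lam₂ * (lam₂ - 2))) ^ (n + 1)
      * (K / (lam * (lam - 2)))) atTop (𝓝 0) ∧
    ∀ n : ℕ, ∀ t, 0 < t → |greenSolI (fun t => sph lam (hyp t)) (sphDecay lam) g t
        - ∑ k ∈ Finset.range (n + 1), (lam * (lam - 2) - lam₂ * (lam₂ - 2)) ^ k
          * (greenSolI (fun t => sph lam₂ (hyp t)) (sphDecay lam₂))^[k + 1] g t|
      ≤ (|lam * (lam - 2) - lam₂ * (lam₂ - 2)| / (lam₂ * (lam₂ - 2))) ^ (n + 1) * (K / (lam * (lam - 2))) := by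
  have hμ₂ : 0 < lam₂ * (lam₂ - 2) := mul_pos (by linarith) (by linarith)
  set q := |lam * (lam - 2) - lam₂ * (lam₂ - 2)| / (lam₂ * (lam₂ - 2)) with hq_def
  have hq0 : 0 ≤ q := by positivity
  have hq1 : q < 1 := by rw [hq_def, div_lt_one hμ₂]; exact hq
  refine ⟨?_, fun n t ht => abs_neumann_remainder_le h2 hg hK h2' n ht⟩
  have h := ((tendsto_pow_atTop_nhds_zero_of_lt_one hq0 hq1).comp (tendsto_add_atTop_nat 1)).mul_const
    (K / (lam * (lam - 2)))
  rwa [zero_mul] at h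

/-- **The row sums of the kernel**: `∫_{(0,∞)} |K_λ(t, s)| sinh 2s ds = 1/μ` for every `t > 0`, `λ > 2`. -/
theorem integral_abs_sphGreenKernel_mul_sinh {lam : ℝ} (h2 : 2 < lam) {t : ℝ} (ht : 0 < t) :
    ∫ s in Ioi 0, |sphGreenKernel lam t s| * Real.sinh (2 * s) = 1 / (lam * (lam - 2)) := by
  have hlam : 1 < lam := by linarith
  have hrep := greenSolI_eq_integral_kernel (φ := fun t => sph lam (hyp t)) (χ := sphDecay lam) (g := fun _ => (1 : ℝ))
    (fun T => integrableOn_sph_mul_one_mul_sinh lam T) (integrableOn_sphDecay_mul_one_mul_sinh h2) ht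
  rw [greenSolI_one_eq hlam h2 ht] at hrep
  have e : (fun s => |sphGreenKernel lam t s| * Real.sinh (2 * s))
      = fun s => -(greenKernel (fun t => sph lam (hyp t)) (sphDecay lam) t s * (1 : ℝ) * Real.sinh (2 * s)) := by
    funext s
    rw [abs_of_neg (sphGreenKernel_neg hlam ht)]
    unfold sphGreenKernel
    ring
  rw [e, MeasureTheory.integral_neg, ← hrep]
  ring

end measure

end Summit.Ventures.HodgeRepro2.T5SU11ResolventSupNorm
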